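import Literature.MathematicalPhysics.QuantumLattice.WilsonFermionBlockAveraging
import HarnessLib

/-!
# Route `FemtoCutoffLadder` — DEFINITIONS: the gauge-covariant THINNING map between spatial tori of sizes `L' ≤ L ≤ 2L'`
# (the «block map for incommensurable pairs» posited by the upward / nested-upper steps of crux `SubOctaveBounded`, stmt-QuantumFields-24085)

Seat `ym-line-fcl-p3` (2026-08-28).  The reshaped incommensurable step of the femto cutoff ladder (upward direction «fine below coarse»,
`Theorems/FemtoCutoffLadderSubOctaveBoundedReshape.lean`; and the planner's nested variant `DyadicNestedUpper`, stmt-QuantumFields-25766) is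
the VARIATIONAL direction: one trial function on the FINE lattice `(ℤ/L)³`, namely the coarse first zero-flux excitation PULLED BACK along a
gauge-covariant map of configurations `GaugeConfig 3 L G → GaugeConfig 3 L' G`.  For nested pairs `L = 2L'` that map is the straight two-link
transporter; this module defines it for EVERY pair `L' ≤ L ≤ 2L'` (no divisibility): coarse coordinate `a ∈ {0,…,L'−1}` sits at fine
coordinate `ι(a) = a + min(a, L − L')` (`thinCoord`), so consecutive coarse sites are `ι(a+1) − ι(a) = 2` fine steps apart for `a < L − L'`
and `1` step apart otherwise (`thinSteps`; cyclically consistent since `ι(L') = L`), and the coarse link `(x', i)` is the ordered product of the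
`1` or `2` fine links of direction `i` from `ι(x')` (`thin`, via the tree's parallel transporter `QuantumLattice.transport`).  `thinLift` places a
coarse configuration on the first fine link of every such path (used to transport left translations, whence Haar-invariance of the image measure).

Proved elsewhere (`FemtoCutoffLadderThinning.lean`): gauge covariance `thin (U^g) = (thin U)^{g ∘ ι}`, twist covariance, `thin_* Haar = Haar`
(products of distinct independent Haar links are Haar), hence the pull-back `ψ ↦ ψ ∘ thin` maps physical zero-flux test functions of the coarse
torus to physical ones of the fine torus isometrically in `L²`.  Definitions only here (route-posited kinematics; not a literature block
average: Bałaban's averaging [cite: Balaban1985Averaging] needs `L' ∣ L`).  R2b1 is a RECORD rung; nothing here proves any step or any summit.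
-/

set_option autoImplicit false

namespace Summit.QuantumFields.YangMills.Theorems.FemtoCutoffLadder.Thinning

open Literature.MathematicalPhysics.QuantumFieldTheory (Site Edge GaugeConfig)
open Literature.MathematicalPhysics.QuantumLattice (transport)

/-- The coordinate embedding `ι : ℤ/L' → ℤ/L`, `ι(a) = a + min(a, L − L')` on representatives `a ∈ {0,…,L'−1}`: the first `L − L'` coarse
steps are stretched to two fine steps, the remaining ones kept at one (for `L' ≤ L ≤ 2L'`; junk otherwise). [folklore] -/
def thinCoord (L L' : ℕ) (a : ZMod L') : ZMod L :=
  ((a.val + min a.val (L - L') : ℕ) : ZMod L)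

/-- The number of fine links (`2` or `1`) covered by the coarse link issuing from coordinate `a`: `ι(a+1) − ι(a)`. [folklore] -/
def thinSteps (L L' : ℕ) (a : ZMod L') : ℕ :=
  if a.val < L - L' then 2 else 1

/-- The site embedding `(ℤ/L')^d → (ℤ/L)^d`, coordinatewise `thinCoord`. [folklore] -/
def thinSite (L : ℕ) {d L' : ℕ} (x' : Site d L') : Site d L :=
  fun j => thinCoord L L' (x' j)

/-- **The thinning map** `GaugeConfig d L G → GaugeConfig d L' G`: the coarse link `(x', i)` is the parallel transporter of the fine
configuration along the straight path of `thinSteps (x' i)` links of direction `i` starting at `thinSite x'` (ordered product, tree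
`QuantumLattice.transport`).  For `L = 2L'` this is the two-link transporter of factor-2 blocking; for `L = L'` the identity. [folklore] -/
def thin {d L : ℕ} (L' : ℕ) {G : Type*} [Monoid G] (U : GaugeConfig d L G) : GaugeConfig d L' G :=
  fun e' => transport U (thinSite L e'.1) (List.replicate (thinSteps L L' (e'.1 e'.2)) e'.2)

open Classical in
/-- The lift of a coarse configuration `W` to the fine torus: `W(x', i)` on the FIRST fine link `(thinSite x', i)` of the path of `(x', i)`,
the identity on every other fine link (so that `thin (thinLift W · U) = W · thin U`). [folklore] -/
noncomputable def thinLift (L : ℕ) {d L' : ℕ} {G : Type*} [Monoid G] (W : GaugeConfig d L' G) : GaugeConfig d L G :=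
  fun e => if h : ∃ x' : Site d L', thinSite L x' = e.1 then W (h.choose, e.2) else 1

end Summit.QuantumFields.YangMills.Theorems.FemtoCutoffLadder.Thinning
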